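import Literature.NumberTheory.EllipticCurves.Kim2025.FineMainIdentitySkinnerUrban
import Literature.NumberTheory.EllipticCurves.Kato2004.EulerSystemClasses
import Literature.NumberTheory.EllipticCurves.Kato2004.DivisibilityInputsFine
import Literature.NumberTheory.EllipticCurves.Rank1Residual.MuLambdaCarriers
import Literature.NumberTheory.EllipticCurves.Rank1Residual.Predicates
import Literature.NumberTheory.EllipticCurves.IwasawaSelmerDualProofs
import Literature.NumberTheory.EllipticCurves.IwasawaSelmerIsTorsionProofs
import Literature.NumberTheory.EllipticCurves.BurungaleTian2026.EtaSignedMainConjectureTensorQ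
import Literature.NumberTheory.EllipticCurves.SkinnerUrban2014.CharacteristicIdealBaseChangeProofs
import Literature.NumberTheory.EllipticCurves.IwasawaAlgebraRankOneIdealProofs
import Literature.NumberTheory.EllipticCurves.PAdicBSDProofs
import Literature.NumberTheory.EllipticCurves.PAdicLFunctionNeZeroHoldsProofs
import Literature.NumberTheory.EllipticCurves.KatoRankBoundProofs
import Literature.NumberTheory.EllipticCurves.GreenbergVatsal2000.CongruentCurves
import Literature.NumberTheory.EllipticCurves.Rank1Residual.MuLeFineMuCarrier
import Summits.BirchSwinnertonDyer.BirchSwinnertonDyer.Theorems.Rank1ResidualX9MuTransfer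
import HarnessLib
import Literature.NumberTheory.EllipticCurves.Kim2025.IwasawaCohomologyZetaQuotientProofs
import Literature.NumberTheory.EllipticCurves.Kato2004.IwasawaCohomologyExistsProofs
import Literature.NumberTheory.EllipticCurves.KatoDivisibilitySkeletonProofs
import Literature.NumberTheory.EllipticCurves.TateModuleContinuityProofs
import Literature.NumberTheory.EllipticCurves.TateModuleFreeProofs
set_option autoImplicit false

-- the summit and its single problem are both named `BirchSwinnertonDyer` (registry layout D-0017)
set_option linter.dupNamespace false

/-!
# Kato's integral divisibility on X9 from Conjecture A, modulo F1 alone; S-W⁺ `Rank1Residual.MuDefectLeFineMuAt` modulo F1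

Cell `bsd-f3-mu`, ES lens (planner-bsd-f3-mu-es g7, MEMO-es §28; sketch HOME/es/MuDefectLeFineMuExact.lean).
Landing file `Summits/BirchSwinnertonDyer/Rank1Residual/SmallImageMu/MuDefectLeFineMu.lean` (filed by the cell typer wi:-,
outside the Theses cone; the `--supports stmt-BirchSwinnertonDyer-20547` wrappers naming the registered stubs are a
prover's one-liners over the theorems below): tree imports only; no new named facts; nothing asserted; 0 sorry.

WHAT IT DOES.  The carrier `Rank1Residual.MuDefectLeFineMuAt W p` («S-W⁺»: for every cyclotomic datum, newform,
dual Selmer datum `D`, f.g. torsion fine datum `Y` and presentation `ch_Λ X = (g)`, `ι g = p^k · L_p(f,α)`: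
`k ≤ μ(Y.X)`) is an OPEN HYPOTHESIS `hSW` of ~30 landed per-pair / class-level closures of the crux
`OneSidedTwistSqueezeX9.KatoDivisibilityX9` (stmt-BirchSwinnertonDyer-20547): the FMW rung
`katoDivisibilityAt_of_rankOneAnchorData(Tam)`, `ConjAAt.katoDivisibilityAt`, `katoDivisibilityOnClassX9_of_conjAOnClassX9'`,
`FineMordellWeilCertificates`, `FirstLayerCertificates`, `EulerPrimitiveEdges`, `ConjARoadBSDp`, …; and it is the
registered STUB 3 `stub_muDefectLeFineMuOnClassX9` of the birth skeleton `Cruxes/KatoDivisibilityX9/Lines/birth.lean`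
(sha16 8dc060a26a11a443).  Its docstring says «to be PROVED from `Kato2004.exists_divisibilityInputs_fineQuotient`»;
no tree theorem concludes it (rg, 2026-08-27T20:20Z).  THIS FILE PROVES IT, at every pair `p ≠ 2` good ordinary
with `E[p]` irreducible (so on all of X9 and beyond), modulo the ONE construction fact F1
`Kato2004.exists_divisibilityInputs_fineQuotient` — and NOT modulo BCS (a): the torsion of `X(E/ℚ_∞)` is read off
the §17.13 package itself (`Kato2004.isTorsion_of_skeleton`, Thm. 17.4 (1)), where es g3's
`muDefectLeFineMuAt_X9_of_F1` (line v3, evidence #20) still imported it from BCS 2025 Thm. 1.1.2 (a).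

§1 algebra over `Λ` (copied from Sketch7 §1, g3/g6, proved);
§2 the exact chart `k + μ(𝐇¹/K.Z) = μ(Y)` over a package (copied from Sketch7 §2, g6, proved; the tree identity
   `Kim2025.lengthAt_add_lengthAt_quotient_zeta_eq_heightOne` at `𝔭 = (p)`);
§3 NEW: `isTorsion_X_of_package` (Thm. 17.4 (1) from the package: no BCS), `muDefectLeFineMuAt_of_fineQuotient`
   (S-W⁺ at the pair mod F1: drop the non-negative Euler-loss term), the two hypothesis SHAPES the tree uses —
   `muDefectLeFineMuOnClassX9_of_fineQuotient` (= STUB 3 with its print binder: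
   `F1 → ∀ W p, ClassX9 W p → MuDefectLeFineMuAt W p`) and `muDefectLeFineMu_shapeS2_of_fineQuotient`
   (`F1 → ∀ W p, p ≠ 2 → good → ordinary → Irr → MuDefectLeFineMuAt W p`, the `hS` binder of `EulerPrimitiveEdges`);
§4–§5b (the hSW-FREE closures of 20547 and the BCS-FREE roads `FineMuZeroAt / ConjAAt / anchor data ⟹
   KatoDivisibilityAt` modulo F1 ALONE, incl. STUB 2) are PART 2, `SmallImageMu/MuDefectLeFineMuEdges.lean`.
READING (MEMO-es §28): after this file the birth skeleton of 20547 is «STUB 1 (statement (A) on X9, the open node) + ONE published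
named fact (F1 = Kato's §17.13 package with its fine quotient)» — S-W⁺ is no longer an input of the line of record.
PARTITION: closes no class (X9 790 = 130 + 36 + 624; X10b 610 + 273); beyond-print theorem: NO (Kato §17.13
bookkeeping at `(p)`; the identity is the tree's [K25] Thm. 3.18 form).

References: K. Kato, Astérisque 295 (2004), Thm. 12.4 (p. 221), Thm. 17.4 (p. 273), Prop. 17.11 (p. 277),
§17.13 (pp. 279–280) [Kato2004Asterisque]; C.-H. Kim, arXiv:2505.09121v1, §3.5.2–3.5.3 [Kim2025RefinedTNC];
L. Washington, GTM 83, §13.2 [Washington1997]; D. Rohrlich, Invent. Math. 75 (1984) [RohrlichInventiones1984];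
C. Wuthrich, J. London Math. Soc. (2) 70 (2004) / JAG 16 (2007) Thm 2, Lemma 3 [Wuthrich2006].
-/

noncomputable section

open scoped Classical MatrixGroups ModularForm NumberField
open CongruenceSubgroup WeierstrassCurve Field
open Literature.NumberTheory.GaloisRepresentations
open Literature.NumberTheory.EllipticCurves Literature.NumberTheory.EllipticCurves.ModularForms
open Literature.NumberTheory.EllipticCurves.Kato2004
open Literature.NumberTheory.EllipticCurves.Kato2004.EulerSystemValues
open Literature.NumberTheory.EllipticCurves.IwasawaDual
open Literature.NumberTheory.EllipticCurves.Rank1Residual (MuAnZeroAt MuAlgZeroAt FineMuZeroAt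
  MuDefectLeFineMuAt MuDefectNonposAt KatoDivisibilityAt MuLeFineMuAt ConjAAt)
open Summit.BirchSwinnertonDyer.BirchSwinnertonDyer.Rank1Residual (ClassX9)
open Module IwasawaAlgebra

namespace Summit.BirchSwinnertonDyer.Rank1Residual.SmallImageMu

universe u

/-! ## §1 Algebra over `Λ = ℤ_p⟦T⟧` (copied from es/EulerLossChart.lean, g3; proved) -/

section Algebra

variable {p : ℕ} [Fact p.Prime]

/-- `Λ/(a)` is a torsion `Λ`-module for `a ≠ 0`. [folklore] -/
private theorem isTorsion_quotient_span_singleton_of_ne_zero {a : IwasawaAlgebra p} (ha : a ≠ 0) :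
    Module.IsTorsion (IwasawaAlgebra p) (IwasawaAlgebra p ⧸ Ideal.span {a}) := by
  intro x
  refine ⟨⟨a, mem_nonZeroDivisors_of_ne_zero ha⟩, ?_⟩
  obtain ⟨y, rfl⟩ := Ideal.Quotient.mk_surjective x
  change a • Ideal.Quotient.mk (Ideal.span {a}) y = 0
  rw [← Ideal.Quotient.mk_eq_mk, ← Submodule.Quotient.mk_smul, Submodule.Quotient.mk_eq_zero,
    smul_eq_mul]
  exact Ideal.mul_mem_right _ _ (Ideal.mem_span_singleton_self a)

/-- **Exponent bookkeeping**: if `ι g = p^k · ι G₁` in `ℚ_p⟦T⟧` (`k ∈ ℤ`, `g, G₁ ∈ Λ`, `G₁ ≠ 0`), then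
`μ(Λ/(g)) = k + μ(Λ/(G₁))`. [cite: Washington1997, §13.2] -/
theorem muInvariant_quotient_eq_of_iota_eq_C_zpow_mul {g G₁ : IwasawaAlgebra p} (hG₁ : G₁ ≠ 0) {k : ℤ}
    (h : iwasawaToPowerSeries p g = PowerSeries.C ((p : ℚ_[p]) ^ k) * iwasawaToPowerSeries p G₁) :
    (muInvariant p (IwasawaAlgebra p ⧸ Ideal.span {g}) : ℤ) =
      k + muInvariant p (IwasawaAlgebra p ⧸ Ideal.span {G₁}) := by
  have hpP : p.Prime := Fact.out
  have hp0 : (p : ℚ_[p]) ≠ 0 := by exact_mod_cast hpP.ne_zero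
  have hιpow : ∀ j : ℕ, iwasawaToPowerSeries p ((p : IwasawaAlgebra p) ^ j) =
      PowerSeries.C ((p : ℚ_[p]) ^ (j : ℤ)) := by
    intro j
    rw [map_pow, map_natCast, zpow_natCast, map_pow, map_natCast]
  by_cases hk : 0 ≤ k
  · obtain ⟨j, rfl⟩ := Int.eq_ofNat_of_zero_le hk
    have hg : g = (p : IwasawaAlgebra p) ^ j * G₁ :=
      iwasawaToPowerSeries_injective p (by rw [map_mul, hιpow, h])
    rw [hg, BurungaleTian2026.muInvariant_quotient_pow_mul hG₁ j]
    push_cast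
    ring
  · obtain ⟨j, hj⟩ := Int.eq_ofNat_of_zero_le (show 0 ≤ -k by omega)
    have hg0 : g ≠ 0 := by
      rintro rfl
      rw [map_zero, eq_comm, mul_eq_zero] at h
      rcases h with h | h
      · exact (zpow_ne_zero k hp0) (by simpa using h)
      · exact hG₁ (iwasawaToPowerSeries_injective p (by rw [h, map_zero]))
    have hG : G₁ = (p : IwasawaAlgebra p) ^ j * g := by
      refine iwasawaToPowerSeries_injective p ?_
      rw [map_mul, hιpow, h, ← mul_assoc, ← map_mul, ← zpow_add₀ hp0, ← hj, neg_add_cancel,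
        zpow_zero, map_one, one_mul]
    rw [hG, BurungaleTian2026.muInvariant_quotient_pow_mul hg0 j]
    push_cast
    omega

end Algebra

/-! ## §2 The EXACT chart over a §17.13 package (copied from Sketch7 §2, g6; μ-currency reading of the tree
identity `Kim2025.lengthAt_add_lengthAt_quotient_zeta_eq_heightOne` at `𝔭 = (p)`) -/

section Chart

variable {p : ℕ} [Fact p.Prime] {W : WeierstrassCurve ℚ} [W.IsElliptic] [W.IsGloballyMinimal]
  [ContinuousSMul ℤ_[p] (W.tateModule p)] {N : ℕ} [NeZero N] {f : CuspForm (Gamma0 N) 2}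
  {κ : ZpExtension ℚ p} {γ : absoluteGaloisGroup ℚ}
  {I : IwasawaH1Data W p κ γ} {D : W.SelmerDualData κ γ}
  {Y : Type u} [AddCommGroup Y] [Module (IwasawaAlgebra p) Y]

omit [NeZero N] in
/-- **The exact Euler-loss chart in `μ`-currency: `μ(X) + μ(𝐇¹/Z) = μ(Λ/(G₁)) + μ(Y)`** for a §17.13
package with `E[p]` irreducible, `ι G₁ = L_p ≠ 0`, an exact fine quotient `π : X ↠ Y`, `X` f.g. torsion.
(`c = 0`: `coker col` finite, Prop. 17.11, built into the tree identity.)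
[cite: Kato2004Asterisque, §17.13 (p. 280), Prop. 17.11 (p. 277), Thm. 16.6 (p. 271)]
[cite: Washington1997, §13.2] -/
theorem mu_add_eulerLoss_eq (K : DivisibilityInputs W p f κ γ I D)
    (hirr : W.HasIrreducibleModPGaloisRep p) {G₁ : IwasawaAlgebra p}
    (hG₁ : iwasawaToPowerSeries p G₁ = padicLFunction f (unitRoot W p : ℚ_[p]))
    (hL : padicLFunction f (unitRoot W p : ℚ_[p]) ≠ 0)
    (π : D.X →ₗ[IwasawaAlgebra p] Y) (hπs : Function.Surjective π) (hπ : Function.Exact K.toX π)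
    [Module.Finite (IwasawaAlgebra p) D.X] (hDt : D.IsTorsion) :
    muInvariant p D.X + muInvariant p (I.H ⧸ K.Z) =
      muInvariant p (IwasawaAlgebra p ⧸ Ideal.span {G₁}) + muInvariant p Y := by
  let 𝔭 : PrimeSpectrum (IwasawaAlgebra p) := ⟨augIdealP p, isPrime_augIdealP_holds p⟩
  have h𝔭1 : 𝔭.asIdeal.height = 1 := height_augIdealP_holds p
  have hG0 : G₁ ≠ 0 := by rintro rfl; exact hL (by rw [← hG₁, map_zero])
  have hA := Kim2025.lengthAt_add_lengthAt_quotient_zeta_eq_heightOne K hirr hG₁ π hπs hπ 𝔭 h𝔭1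
  have hXfin : lengthAt (IwasawaAlgebra p) D.X 𝔭 ≠ ⊤ := lengthAt_ne_top_of_isTorsion p _ hDt 𝔭 rfl
  have hGfin : lengthAt (IwasawaAlgebra p) (IwasawaAlgebra p ⧸ Ideal.span {G₁}) 𝔭 ≠ ⊤ :=
    lengthAt_ne_top_of_isTorsion p _ (isTorsion_quotient_span_singleton_of_ne_zero hG0) 𝔭 rfl
  have hYle : lengthAt (IwasawaAlgebra p) Y 𝔭 ≤ lengthAt (IwasawaAlgebra p) D.X 𝔭 :=
    lengthAt_le_of_surjective π hπs 𝔭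
  have hYfin : lengthAt (IwasawaAlgebra p) Y 𝔭 ≠ ⊤ := ne_top_of_le_ne_top hXfin hYle
  have hZfin : lengthAt (IwasawaAlgebra p) (I.H ⧸ K.Z) 𝔭 ≠ ⊤ := by
    refine ne_top_of_le_ne_top (WithTop.add_ne_top.mpr ⟨hGfin, hYfin⟩) ?_
    exact le_trans le_add_self hA.le
  obtain ⟨x, hx⟩ := ENat.ne_top_iff_exists.mp hXfin
  obtain ⟨m, hm⟩ := ENat.ne_top_iff_exists.mp hGfin
  obtain ⟨y, hy⟩ := ENat.ne_top_iff_exists.mp hYfin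
  obtain ⟨d, hd⟩ := ENat.ne_top_iff_exists.mp hZfin
  rw [← hx, ← hm, ← hy, ← hd] at hA
  have hA' : x + d = m + y := by exact_mod_cast hA
  have hμX : muInvariant p D.X = x := by
    rw [muInvariant_eq_toNat_lengthAt p _ 𝔭 rfl, ← hx, ENat.toNat_coe]
  have hμY : muInvariant p Y = y := by
    rw [muInvariant_eq_toNat_lengthAt p _ 𝔭 rfl, ← hy, ENat.toNat_coe]
  have hμZ : muInvariant p (I.H ⧸ K.Z) = d := by
    rw [muInvariant_eq_toNat_lengthAt p _ 𝔭 rfl, ← hd, ENat.toNat_coe]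
  have hμG : muInvariant p (IwasawaAlgebra p ⧸ Ideal.span {G₁}) = m := by
    rw [muInvariant_eq_toNat_lengthAt p _ 𝔭 rfl, ← hm, ENat.toNat_coe]
  rw [hμX, hμZ, hμG, hμY]
  exact hA'

/-- **The exact chart in the exponent currency: `k + μ(𝐇¹/Z) = μ(Y)`** — for `X` f.g. torsion with
`ch X = (g)`, `ι g = p^k · L_p(E,T)` (`k ∈ ℤ` = the cell's `μ`-defect, `MuDefectNonposAt` asks `k ≤ 0`),
`E[p]` irreducible, `p` good ordinary: the Euler-system machinery loses EXACTLY `δ_Z := μ(𝐇¹/Z)`, i.e.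
**`k = μ(X₀) − δ_Z`** with `Y = X₀`. (g3 had `≤`.) [cite: Kato2004Asterisque, §17.13 (pp. 279–280)]
[cite: Washington1997, §13.2] [cite: RohrlichInventiones1984, Theorem (p. 409)] -/
theorem muDefect_add_eulerLoss_eq (K : DivisibilityInputs W p f κ γ I D)
    (hirr : W.HasIrreducibleModPGaloisRep p) (hord : IsOrdinaryAt W p) (hf : IsNewformOf W f)
    {G₁ : IwasawaAlgebra p}
    (hG₁ : iwasawaToPowerSeries p G₁ = padicLFunction f (unitRoot W p : ℚ_[p]))
    (π : D.X →ₗ[IwasawaAlgebra p] Y) (hπs : Function.Surjective π) (hπ : Function.Exact K.toX π)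
    [Module.Finite (IwasawaAlgebra p) D.X] (hDt : D.IsTorsion)
    {g : IwasawaAlgebra p} {k : ℤ} (hchar : D.charIdeal = Ideal.span {g})
    (hι : iwasawaToPowerSeries p g =
      PowerSeries.C ((p : ℚ_[p]) ^ k) * padicLFunction f (unitRoot W p : ℚ_[p])) :
    k + (muInvariant p (I.H ⧸ K.Z) : ℤ) = (muInvariant p Y : ℤ) := by
  have hpP : p.Prime := Fact.out
  let 𝔭 : PrimeSpectrum (IwasawaAlgebra p) := ⟨augIdealP p, isPrime_augIdealP_holds p⟩
  have h𝔭1 : 𝔭.asIdeal.height = 1 := height_augIdealP_holds p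
  have hL : padicLFunction f (unitRoot W p : ℚ_[p]) ≠ 0 := padicLFunction_unitRoot_ne_zero hord hf
  have hG0 : G₁ ≠ 0 := by rintro rfl; exact hL (by rw [← hG₁, map_zero])
  have hp0 : (p : ℚ_[p]) ≠ 0 := by exact_mod_cast hpP.ne_zero
  have hg0 : g ≠ 0 := by
    rintro rfl
    rw [map_zero, eq_comm, mul_eq_zero] at hι
    rcases hι with h | h
    · exact (zpow_ne_zero k hp0) (by simpa using h)
    · exact hL h
  have h := mu_add_eulerLoss_eq K hirr hG₁ hL π hπs hπ hDt
  -- `μ(X) = μ(Λ/(g))` (characteristic ideal) and `μ(Λ/(g)) = k + μ(Λ/(G₁))`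
  have hXg : lengthAt (IwasawaAlgebra p) D.X 𝔭 =
      lengthAt (IwasawaAlgebra p) (IwasawaAlgebra p ⧸ Ideal.span {g}) 𝔭 :=
    SkinnerUrban2014.lengthAt_eq_of_charIdeal_eq hDt (isTorsion_quotient_span_singleton_of_ne_zero hg0)
      (hchar.trans (charIdeal_quotient_span_singleton hg0).symm) 𝔭 h𝔭1
  have hμXg : muInvariant p D.X = muInvariant p (IwasawaAlgebra p ⧸ Ideal.span {g}) := by
    rw [muInvariant_eq_toNat_lengthAt p _ 𝔭 rfl, muInvariant_eq_toNat_lengthAt p _ 𝔭 rfl, hXg]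
  have hrel := muInvariant_quotient_eq_of_iota_eq_C_zpow_mul hG0 (k := k) (g := g) (by rw [hι, hG₁])
  have h' : (muInvariant p D.X : ℤ) + muInvariant p (I.H ⧸ K.Z) =
      muInvariant p (IwasawaAlgebra p ⧸ Ideal.span {G₁}) + muInvariant p Y := by exact_mod_cast h
  rw [hμXg] at h'
  omega

/-- **`X(E/ℚ_∞)` is `Λ`-torsion, read off the §17.13 package itself** (Kato Thm. 17.4 (1): `X` is an extension of
a submodule of the torsion `𝐇²` by `P/loc(𝐇¹)`, killed by `G = col(loc z)`, `ι G = p^n · L_p ≠ 0` by Rohrlich) —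
NO appeal to BCS 2025 Thm. 1.1.2 (a).  [cite: Kato2004Asterisque, Thm. 17.4 (1) (p. 273) and §17.13 (p. 280)]
[cite: RohrlichInventiones1984, Theorem (p. 409)] -/
theorem isTorsion_X_of_package (K : DivisibilityInputs W p f κ γ I D) (hord : IsOrdinaryAt W p)
    (hf : IsNewformOf W f) : D.IsTorsion := by
  obtain ⟨z, -, hz⟩ := Submodule.mem_map.mp K.pow_mem
  simp only [LinearMap.coe_comp, Function.comp_apply] at hz
  exact isTorsion_of_skeleton K.loc K.toX K.δ K.exact_P K.exact_X K.col K.col_injective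
    (Kim2025.G_ne_zero K hord hf) hz K.isTorsion_H2

/-- **§5a — BCS-FREE, per package: if the fine local length is absorbed by the Euler loss at `𝔭 = (p)`
(`ℓ_(p)(Y) ≤ ℓ_(p)(𝐇¹/K.Z)`), then `G₁ ∈ ch_Λ X(E/ℚ_∞)` for every `G₁` with `ι G₁ = L_p(f, α)` — Kato's
INTEGRAL one-sided divisibility, with NO appeal to BCS 2025 and NO image hypothesis beyond `Irr(E[p])`.**
Proof (Kato's own Thm. 17.4 (3) argument with the `(p)`-part input replaced): at every height-one `𝔭` the
tree identity `ℓ_𝔭(X) + ℓ_𝔭(𝐇¹/Z) = ℓ_𝔭(Λ/(G₁)) + ℓ_𝔭(Y)` ([K25] Thm. 3.18 form,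
`Kim2025.lengthAt_add_lengthAt_quotient_zeta_eq_heightOne`); off `(p)` Kato's Euler-system bound
`ℓ_𝔭(Y) ≤ ℓ_𝔭(𝐇¹/Z)` (package field `es_bound`, Thm. 12.5 (3) / 13.4 (2), image-free there;
`Kim2025.lengthAt_fine_le_lengthAt_quotient_zeta_offP`); at `(p)` the hypothesis; `ℓ_𝔭(𝐇¹/Z) < ∞`
(`𝐇¹/Z` torsion, Kato–Rohrlich); hence `ℓ_𝔭(X) ≤ ℓ_𝔭(Λ/(G₁))` everywhere and `G₁ ∈ char X`
(`char = ∏ 𝔭^{ℓ_𝔭}`, `Module.mem_charIdeal_of_lengthAt_le`).  `X` is torsion by Thm. 17.4 (1) from the package.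
[cite: Kato2004Asterisque, Thm. 12.5 (3) (p. 222), Thm. 13.4 (2) (p. 226), Thm. 17.4 (p. 273), §17.13 (pp. 279–280)]
[cite: Kim2025RefinedTNC, Thm. 3.18 (1) (§3.5.3)] [cite: Washington1997, §13.2] -/
theorem mem_charIdeal_of_fineLength_le_eulerLoss (K : DivisibilityInputs W p f κ γ I D)
    (hirr : W.HasIrreducibleModPGaloisRep p) (hord : IsOrdinaryAt W p) (hf : IsNewformOf W f)
    {G₁ : IwasawaAlgebra p}
    (hG₁ : iwasawaToPowerSeries p G₁ = padicLFunction f (unitRoot W p : ℚ_[p]))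
    (π : D.X →ₗ[IwasawaAlgebra p] Y) (hπs : Function.Surjective π) (hπ : Function.Exact K.toX π)
    [Module.Finite (IwasawaAlgebra p) D.X]
    (hY : ∀ 𝔭 : PrimeSpectrum (IwasawaAlgebra p), 𝔭.asIdeal = augIdealP p →
      lengthAt (IwasawaAlgebra p) Y 𝔭 ≤ lengthAt (IwasawaAlgebra p) (I.H ⧸ K.Z) 𝔭) :
    G₁ ∈ D.charIdeal := by
  have hDt : D.IsTorsion := isTorsion_X_of_package K hord hf
  have hG0 : G₁ ≠ 0 := by
    rintro rfl
    apply Kim2025.G_ne_zero K hord hf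
    apply iwasawaToPowerSeries_injective p
    rw [K.ιG_eq, ← hG₁, map_zero, mul_zero]
  haveI : Module.Finite (IwasawaAlgebra p) I.H := Kim2025.moduleFinite_H1_of_package K
  have hQt : Module.IsTorsion (IwasawaAlgebra p) (I.H ⧸ K.Z) := Kim2025.isTorsion_quotient_zeta K hord hf
  refine mem_charIdeal_of_lengthAt_le hDt hG0 fun 𝔭 h𝔭 => ?_
  have hid := Kim2025.lengthAt_add_lengthAt_quotient_zeta_eq_heightOne K hirr hG₁ π hπs hπ 𝔭 h𝔭
  have hYle : lengthAt (IwasawaAlgebra p) Y 𝔭 ≤ lengthAt (IwasawaAlgebra p) (I.H ⧸ K.Z) 𝔭 := by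
    by_cases hp𝔭 : PowerSeries.C (p : ℤ_[p]) ∈ 𝔭.asIdeal
    · exact hY 𝔭 (Kim2025.asIdeal_eq_augIdealP_of_C_mem 𝔭 h𝔭 hp𝔭)
    · exact Kim2025.lengthAt_fine_le_lengthAt_quotient_zeta_offP K π hπs hπ 𝔭 h𝔭 hp𝔭
  have hXfin : lengthAt (IwasawaAlgebra p) D.X 𝔭 ≠ ⊤ :=
    IwasawaAlgebra.lengthAt_ne_top_of_isTorsion (N := D.X) (hN := hDt) (𝔮 := 𝔭) (h𝔮 := h𝔭.le)
  have hGfin : lengthAt (IwasawaAlgebra p) (IwasawaAlgebra p ⧸ Ideal.span {G₁}) 𝔭 ≠ ⊤ :=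
    IwasawaAlgebra.lengthAt_ne_top_of_isTorsion (N := IwasawaAlgebra p ⧸ Ideal.span {G₁})
      (hN := isTorsion_quotient_span_singleton_of_ne_zero hG0) (𝔮 := 𝔭) (h𝔮 := h𝔭.le)
  have hYX : lengthAt (IwasawaAlgebra p) Y 𝔭 ≤ lengthAt (IwasawaAlgebra p) D.X 𝔭 :=
    lengthAt_le_of_surjective π hπs 𝔭
  have hYfin : lengthAt (IwasawaAlgebra p) Y 𝔭 ≠ ⊤ := ne_top_of_le_ne_top hXfin hYX
  have hZfin : lengthAt (IwasawaAlgebra p) (I.H ⧸ K.Z) 𝔭 ≠ ⊤ := by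
    refine ne_top_of_le_ne_top (WithTop.add_ne_top.mpr ⟨hGfin, hYfin⟩) ?_
    exact le_trans le_add_self hid.le
  obtain ⟨x, hx⟩ := ENat.ne_top_iff_exists.mp hXfin
  obtain ⟨m, hm⟩ := ENat.ne_top_iff_exists.mp hGfin
  obtain ⟨y, hy⟩ := ENat.ne_top_iff_exists.mp hYfin
  obtain ⟨d, hd⟩ := ENat.ne_top_iff_exists.mp hZfin
  rw [← hx, ← hm, ← hy, ← hd] at hid
  rw [← hy, ← hd] at hYle
  rw [← hx, ← hm]
  have hid' : x + d = m + y := by exact_mod_cast hid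
  have hYle' : y ≤ d := by exact_mod_cast hYle
  exact_mod_cast (show x ≤ m by omega)

/-- **§5a′ — the `μ`-currency form: `μ(Y) ≤ μ(𝐇¹/K.Z)` (fine `μ` absorbed by the Euler loss) ⟹ `G₁ ∈ char X`.**
This is item 20547's body per package (`k ≤ 0 ↔ μ(Y) ≤ μ(𝐇¹/Z)`, MEMO-es §27.2) turned into the DIVISIBILITY
itself without BCS. [cite: Kato2004Asterisque, Thm. 17.4 (p. 273), §17.13 (pp. 279–280)] [cite: Washington1997, §13.2] -/
theorem mem_charIdeal_of_fineMu_le_eulerLoss (K : DivisibilityInputs W p f κ γ I D)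
    (hirr : W.HasIrreducibleModPGaloisRep p) (hord : IsOrdinaryAt W p) (hf : IsNewformOf W f)
    {G₁ : IwasawaAlgebra p}
    (hG₁ : iwasawaToPowerSeries p G₁ = padicLFunction f (unitRoot W p : ℚ_[p]))
    (π : D.X →ₗ[IwasawaAlgebra p] Y) (hπs : Function.Surjective π) (hπ : Function.Exact K.toX π)
    [Module.Finite (IwasawaAlgebra p) D.X] [Module.Finite (IwasawaAlgebra p) Y]
    (hYt : Module.IsTorsion (IwasawaAlgebra p) Y)
    (hμ : muInvariant p Y ≤ muInvariant p (I.H ⧸ K.Z)) : G₁ ∈ D.charIdeal := by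
  refine mem_charIdeal_of_fineLength_le_eulerLoss K hirr hord hf hG₁ π hπs hπ fun 𝔭 h𝔭 => ?_
  have hYfin : lengthAt (IwasawaAlgebra p) Y 𝔭 ≠ ⊤ := lengthAt_ne_top_of_isTorsion p _ hYt 𝔭 h𝔭
  obtain ⟨y, hy⟩ := ENat.ne_top_iff_exists.mp hYfin
  have hμY : muInvariant p Y = y := by
    rw [muInvariant_eq_toNat_lengthAt p _ 𝔭 h𝔭, ← hy, ENat.toNat_coe]
  by_cases hZ : lengthAt (IwasawaAlgebra p) (I.H ⧸ K.Z) 𝔭 = ⊤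
  · rw [hZ]; exact le_top
  obtain ⟨d, hd⟩ := ENat.ne_top_iff_exists.mp hZ
  have hμZ : muInvariant p (I.H ⧸ K.Z) = d := by
    rw [muInvariant_eq_toNat_lengthAt p _ 𝔭 h𝔭, ← hd, ENat.toNat_coe]
  rw [← hy, ← hd]
  rw [hμY, hμZ] at hμ
  exact_mod_cast hμ

end Chart

/-! ## §3 NEW — S-W⁺ at the pair and on X9, modulo F1 alone -/

section PerPair

variable {p : ℕ} [Fact p.Prime] {W : WeierstrassCurve ℚ} [W.IsElliptic] [W.IsGloballyMinimal]

/-- **S-W⁺ at the pair, modulo F1 ONLY: `Rank1Residual.MuDefectLeFineMuAt W p`** at every `p ≠ 2` good ordinary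
with `E[p]` irreducible.  For the data of the carrier (`D`, a f.g. torsion fine datum `Y`, `ch X = (g)`,
`ι g = p^k · L_p(f,α)`): F1 gives a §17.13 package `K` with an exact fine quotient `X ↠ Y.X`; `X` is torsion by
`isTorsion_X_of_package`; the exact chart reads `k + μ(𝐇¹/K.Z) = μ(Y.X)`, and `μ(𝐇¹/K.Z) ≥ 0`.
(The carrier's binders `Module.Finite Y.X`, `Module.IsTorsion Y.X` are not even used: both follow from the
package, `Kim2025.isTorsion_fine_of_package`.)  [cite: Kato2004Asterisque, Thm. 17.4 (p. 273), §17.13 (pp. 279–280)]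
[cite: Kim2025RefinedTNC, Thm. 3.18 (§3.5.3)] [cite: Washington1997, §13.2] -/
theorem muDefectLeFineMuAt_of_fineQuotient (hfine : exists_divisibilityInputs_fineQuotient)
    (hp2 : p ≠ 2) (hord : IsOrdinaryAt W p) (hirr : W.HasIrreducibleModPGaloisRep p) :
    MuDefectLeFineMuAt W p := by
  intro κ γ N _ f hκ hγ hγ' hf D Y g k _hYf _hYt hchar hι
  haveI : ContinuousSMul ℤ_[p] (W.tateModule p) := TateModule.continuousSMul_padicInt
  haveI : Module.Finite (IwasawaAlgebra p) D.X :=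
    WeierstrassCurve.SelmerDualData.module_finite_of_isCyclotomic W κ hκ D hγ
  obtain ⟨I⟩ := Kato2004.nonempty_iwasawaH1Data_holds W p κ γ hκ hγ
  obtain ⟨K, π, hπs, hπ⟩ := hfine W p f κ γ hp2 hord hκ hγ hγ' hf I D Y
  obtain ⟨G₁, hG₁⟩ := exists_iwasawaToPowerSeries_eq_padicLFunction hp2 hord hf hirr
  have hDt : D.IsTorsion := isTorsion_X_of_package K hord hf
  have h := muDefect_add_eulerLoss_eq K hirr hord hf hG₁ π hπs hπ hDt hchar hι
  have h0 : (0 : ℤ) ≤ (muInvariant p (I.H ⧸ K.Z) : ℤ) := Nat.cast_nonneg _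
  omega

/-- **STUB 3 of `Lines/birth.lean` WITH ITS PRINT BINDER (shape S1): `F1 → ∀ W p, ClassX9 W p → MuDefectLeFineMuAt W p`.**
On X9 `p ≥ 5` is good ordinary and `E[p]` irreducible (fields of `ClassX9`), so the previous theorem applies.
This is the `hSW` binder of `katoDivisibilityOnClassX9_of_conjAOnClassX9'`, `ConjARoadBSDp`, the FMW-rung cover
theorem, `FineMordellWeilCriteriaEdges`, `FirstLayerCriteriaEdges` — all of which already carry `hfine`.
[cite: Kato2004Asterisque, §17.13 (pp. 279–280)] -/
theorem muDefectLeFineMuOnClassX9_of_fineQuotient (hfine : exists_divisibilityInputs_fineQuotient) :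
    ∀ (W : WeierstrassCurve ℚ) [W.IsElliptic] [W.IsGloballyMinimal] (p : ℕ) [Fact p.Prime],
      ClassX9 W p → MuDefectLeFineMuAt W p := by
  intro W _ _ p _ hX9
  obtain ⟨-, hp5, hgood, hap, hirr, -⟩ := id hX9
  exact muDefectLeFineMuAt_of_fineQuotient hfine (by omega) ⟨hgood, hap⟩ hirr

/-- **Shape S2 (the `hS` binder of `EulerPrimitiveEdges.muDefectNonposAt_of_eulerPrimitiveOnClassX9` /
`katoDivisibilityOnClassX9_of_eulerPrimitiveOnClassX9`): `F1 → ∀ W p, p ≠ 2 → good → ordinary → Irr → S-W⁺`.**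
(Those theorems carry `F1_ζ`; `Kato2004.exists_divisibilityInputs_fineQuotient_of_zeta` turns it into F1 under
the Tate-module instances they already bind.) [cite: Kato2004Asterisque, §17.13 (pp. 279–280)] -/
theorem muDefectLeFineMu_shapeS2_of_fineQuotient (hfine : exists_divisibilityInputs_fineQuotient) :
    ∀ (W : WeierstrassCurve ℚ) [W.IsElliptic] [W.IsGloballyMinimal] (p : ℕ) [Fact p.Prime],
      p ≠ 2 → W.HasGoodReductionAtPrime p → ¬ (p : ℤ) ∣ W.frobeniusTrace p →
      W.HasIrreducibleModPGaloisRep p → MuDefectLeFineMuAt W p :=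
  fun _ _ _ _ _ hp2 hgood hap hirr ↦ muDefectLeFineMuAt_of_fineQuotient hfine hp2 ⟨hgood, hap⟩ hirr

/-- **F1_ζ ⟹ F1 as CLOSED named facts** (the tree's `exists_divisibilityInputs_fineQuotient_of_zeta` keeps the
Tate-module structure facts as instance binders; here they are discharged by name,
`module_free_tateModule_holds` / `module_finite_tateModule_holds`), so every `hfine`-road is also an `F1_ζ`-road.
[cite: Kato2004Asterisque, Thm. 12.6 (p. 222), (14.9.3) (p. 240) and §17.13 (p. 279)] -/
theorem fineQuotient_of_zeta (h : exists_divisibilityInputs_fineQuotient_zeta) :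
    exists_divisibilityInputs_fineQuotient := by
  intro W _ _ p _ _ N _ f κ γ hp hord hκ hγ hγ' hf I D Y
  haveI : Module.Free ℤ_[p] (W.tateModule p) := W.module_free_tateModule_holds p
  haveI : Module.Finite ℤ_[p] (W.tateModule p) := W.module_finite_tateModule_holds p
  exact exists_divisibilityInputs_fineQuotient_of_zeta h W p f κ γ hp hord hκ hγ hγ' hf I D Y

end PerPair

end Summit.BirchSwinnertonDyer.Rank1Residual.SmallImageMu

end
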